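import Literature.NumberTheory.DiophantineGeometry.AbcShapeGeometrySets
import Literature.NumberTheory.DiophantineGeometry.CongruenceLatticeBoxCount
import Summits.ABC.ABC.Theorems.TwistAmplificationMazurKaneLawDetToolRoots

-- Summit.ABC.ABC is the mandated summit-side namespace (single-conjunct summit); the lakefile sets the same option tree-wide.
set_option linter.dupNamespace false

/-!
# The square-root lattice tool for the shape count `B_d`, host the `x`-term (crux stmt-ABC-2757, stub `sqrtLatticeToolX`)

Stub S6 of the line `fibre-toolkit-lp-wall-map` for the crux
`Summit.ABC.ABC.Theses.TwistAmplification.MazurKaneLaw`.  The shape count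
`B_d = AbcShapes.shapeCount c₁ c₂ c₃ X Y Z` counts the `(x, y, z)` in the dyadic boxes
`[X, 2X) × [Y, 2Y) × [Z, 2Z)` with `c₁ ∏ xⱼ^{j+1} + c₂ ∏ yⱼ^{j+1} = c₃ ∏ zⱼ^{j+1}` and
`gcd(c₁ ∏ xⱼ, c₂ ∏ yⱼ, c₃ ∏ zⱼ) = 1`.  The tool (`Summit.ABC.ABC.Theorems.MazurKaneLaw.sqrtLatticeToolX`)
bounds `B_d` for a set `H` of host coordinates (in the `x`-term) and a coordinate `i ≥ 1`
(level `k = i + 1 ≥ 2` in the two other terms):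

* freeze the `x`-coordinates off `H` and the `y`-, `z`-coordinates other than `i` (fibres indexed by
  `subBox H X × subBox {i} Y × subBox {i} Z`, exactly as in `AbcShapes.shapeCount_le_geometry_sets`);
  on the fibre over `(r₁, r₂, r₃)` the equation reads `A·m + B·y^k = C·z^k` with
  `A = c₁ offVal_H(r₁) ≥ c₁ offVal_H(X)`, `B = c₂ offVal_{i}(r₂)`, `C = c₃ offVal_{i}(r₃)`,
  `m = W_H(x)`, `y = yᵢ < 2Yᵢ`, `z = zᵢ < 2Zᵢ`, and the three terms are pairwise coprime
  (`AbcShapes.coprime_terms_of_mem`), so `y, z, C` are units modulo `A` and `gcd(y, z) = 1`;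
* the root class `λ = z·y⁻¹ ∈ ZMod A` of a solution satisfies `C λ^k = B`, so all classes met lie in
  one coset of the `k`-th roots of unity: at most `#μ_k(ZMod A) ≤ τ(A)^{k+1} ≤ Dτ^{i+2}` classes
  (`natCard_rootsOfUnity_le_pow`);
* for a fixed class (integer lift `Λ`) the pairs `(y, z)` are primitive points of the congruence
  lattice `A ∣ Λ y − z` in the box `|y| ≤ 2Yᵢ`, `|z| ≤ 2Zᵢ`: at most `2 + 28·(2Yᵢ)(2Zᵢ)/A`
  of them (`card_box_filter_coprime_congr_le`, `gcd(Λ, −1) = 1`);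
* `(y, z)` determines `m = W_H(x)`, and the host tuples `x_H` with that value number `≤ τ(m)^d ≤ Dτ^d`
  (`AbcShapes.card_subBox_filter_dvd_le`);
* summing over the `#subBox_H X · #subBox_{i} Y · #subBox_{i} Z` fibres gives the stated bound
  `B_d ≤ #fibres · Dτ^{d+(i+2)} · (2 + 112 YᵢZᵢ/(c₁ offVal_H X))`.

No new definitions; `card_pairs_rootClass_le` is the self-contained count of the pairs `(y, z)` on
one fibre (root classes times primitive lattice points).
-/

namespace Summit.ABC.ABC.Theorems.MazurKaneLaw

open Finset
open Literature.NumberTheory.DiophantineGeometry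
open Literature.NumberTheory.DiophantineGeometry.AbcShapes

/-! ### Pairs on one fibre: root classes times primitive lattice points -/

/-- **Pairs on one fibre of the square-root lattice tool.** Let `A ≥ 1`, `C` coprime to `A`, and let
`P` be a set of pairs `(y, z)` of naturals with `y ≤ N₁`, `z ≤ N₂`, `gcd(y, z) = 1`, `y, z` coprime
to `A` and `B y^k = C z^k` in `ZMod A`.  Then `#P ≤ #μ_k(ZMod A) · (2 + 28 N₁N₂/A)`: the root class
`λ = z y⁻¹` satisfies `C λ^k = B`, so the classes met lie in one coset of the `k`-th roots of unity,
and the pairs of a fixed class `λ` are primitive points of the congruence lattice `A ∣ Λ y − z`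
(`Λ` a lift of `λ`), counted by `card_box_filter_coprime_congr_le`. [folklore] -/
theorem card_pairs_rootClass_le {A : ℕ} (hA : 0 < A) {C : ℕ} (hCA : C.Coprime A) (B k N₁ N₂ : ℕ)
    (P : Finset (ℕ × ℕ))
    (hP : ∀ w ∈ P, (w.1 ≤ N₁ ∧ w.2 ≤ N₂) ∧ Nat.Coprime w.1 w.2 ∧ Nat.Coprime w.1 A ∧
      Nat.Coprime w.2 A ∧ (B : ZMod A) * (w.1 : ZMod A) ^ k = (C : ZMod A) * (w.2 : ZMod A) ^ k) :
    (P.card : ℝ) ≤ Nat.card {ρ : ZMod A // ρ ^ k = 1} * (2 + 28 * (N₁ : ℝ) * N₂ / A) := by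
  classical
  haveI : NeZero A := ⟨hA.ne'⟩
  rcases P.eq_empty_or_nonempty with he | ⟨w₀, hw₀⟩
  · rw [he, card_empty, Nat.cast_zero]; positivity
  have hunit : ∀ {m : ℕ}, m.Coprime A → IsUnit (m : ZMod A) := fun h =>
    (ZMod.isUnit_iff_coprime _ _).mpr h
  -- the root class `z · y⁻¹ (mod A)` of a pair
  set cls : ℕ × ℕ → ZMod A := fun w => (w.2 : ZMod A) * ((w.1 : ZMod A))⁻¹ with hcls
  have hcls1 : ∀ w ∈ P, cls w * (w.1 : ZMod A) = (w.2 : ZMod A) := by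
    intro w hw
    obtain ⟨-, -, h1, -, -⟩ := hP w hw
    simp only [hcls]
    rw [mul_assoc, ZMod.inv_mul_of_unit _ (hunit h1), mul_one]
  have hclsk : ∀ w ∈ P, (C : ZMod A) * cls w ^ k = (B : ZMod A) := by
    intro w hw
    obtain ⟨-, -, h1, -, heq⟩ := hP w hw
    refine (((hunit h1).pow k).mul_left_inj).mp ?_
    rw [mul_assoc, ← mul_pow, hcls1 w hw]
    exact heq.symm
  -- the classes met lie in one coset of the `k`-th roots of unity
  have hCl : (P.image cls).card ≤ Nat.card {ρ : ZMod A // ρ ^ k = 1} := by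
    obtain ⟨-, -, hy₀, hz₀, -⟩ := hP w₀ hw₀
    set μ : ZMod A := (w₀.1 : ZMod A) * ((w₀.2 : ZMod A))⁻¹ with hμ
    have hμ1 : cls w₀ * μ = 1 := by
      rw [hμ, ← mul_assoc, hcls1 w₀ hw₀, ZMod.mul_inv_of_unit _ (hunit hz₀)]
    have hμ2 : ∀ x : ZMod A, x * μ * (w₀.2 : ZMod A) = x * (w₀.1 : ZMod A) := fun x => by
      rw [hμ, mul_assoc, mul_assoc, ZMod.inv_mul_of_unit _ (hunit hz₀), mul_one]
    have hmemk : ∀ x ∈ P.image cls, (x * μ) ^ k = 1 := by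
      intro x hx
      obtain ⟨w, hw, rfl⟩ := mem_image.mp hx
      have h1 : cls w ^ k = cls w₀ ^ k :=
        ((hunit hCA).mul_right_inj).mp ((hclsk w hw).trans (hclsk w₀ hw₀).symm)
      rw [mul_pow, h1, ← mul_pow, hμ1, one_pow]
    rw [← Nat.card_eq_finsetCard]
    refine Nat.card_le_card_of_injective
      (fun x : {x // x ∈ P.image cls} => (⟨x.1 * μ, hmemk x.1 x.2⟩ : {ρ : ZMod A // ρ ^ k = 1})) ?_
    intro x x' h
    have h1 : x.1 * μ = x'.1 * μ := congrArg Subtype.val h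
    have h2 : x.1 * (w₀.1 : ZMod A) = x'.1 * (w₀.1 : ZMod A) := by rw [← hμ2, ← hμ2, h1]
    exact Subtype.ext (((hunit hy₀).mul_left_inj).mp h2)
  -- each class is a congruence lattice; its primitive points in the box are few
  have hclass : ∀ x ∈ P.image cls,
      (((P.filter fun w => cls w = x).card : ℕ) : ℝ) ≤ 2 + 28 * (N₁ : ℝ) * N₂ / A := by
    intro x _
    have hv : Nat.Coprime (Int.gcd (x.val : ℤ) (-1)) A := by
      rw [Int.isCoprime_iff_gcd_eq_one.mp isCoprime_one_right.neg_right]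
      exact Nat.coprime_one_left _
    refine le_trans ?_ (card_box_filter_coprime_congr_le hA hv N₁ N₂)
    have hinj : (P.filter fun w => cls w = x).card ≤
        ((Icc (-(N₁ : ℤ)) N₁ ×ˢ Icc (-(N₂ : ℤ)) N₂).filter
          (fun w => Int.gcd w.1 w.2 = 1 ∧ (A : ℤ) ∣ (x.val : ℤ) * w.1 + (-1) * w.2)).card := by
      refine card_le_card_of_injOn (fun w => ((w.1 : ℤ), (w.2 : ℤ))) (fun w hw => ?_)
        (fun w _ w' _ h => ?_)
      · obtain ⟨hwP, hwx⟩ := mem_filter.mp (mem_coe.mp hw)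
        obtain ⟨⟨h1, h2⟩, hcop, -, -, -⟩ := hP w hwP
        dsimp only
        rw [mem_coe, mem_filter, mem_product, mem_Icc, mem_Icc]
        refine ⟨⟨⟨by omega, by omega⟩, by omega, by omega⟩, ?_, ?_⟩
        · rw [Int.gcd_natCast_natCast]; exact hcop
        · rw [← ZMod.intCast_zmod_eq_zero_iff_dvd]
          simp only [Int.cast_add, Int.cast_mul, Int.cast_natCast, Int.cast_neg, Int.cast_one]
          rw [ZMod.natCast_zmod_val, ← hwx, neg_one_mul, hcls1 w hwP, add_neg_cancel]
      · dsimp only at h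
        simp only [Prod.mk.injEq, Nat.cast_inj] at h
        exact Prod.ext h.1 h.2
    exact_mod_cast hinj
  calc (P.card : ℝ) = ∑ x ∈ P.image cls, (((P.filter fun w => cls w = x).card : ℕ) : ℝ) := by
        rw [card_eq_sum_card_image cls P]; push_cast; rfl
    _ ≤ ∑ x ∈ P.image cls, (2 + 28 * (N₁ : ℝ) * N₂ / A) := sum_le_sum hclass
    _ = (P.image cls).card * (2 + 28 * (N₁ : ℝ) * N₂ / A) := by rw [sum_const, nsmul_eq_mul]
    _ ≤ Nat.card {ρ : ZMod A // ρ ^ k = 1} * (2 + 28 * (N₁ : ℝ) * N₂ / A) :=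
        mul_le_mul_of_nonneg_right (by exact_mod_cast hCl) (by positivity)

/-! ### The tool -/

/-- **The square-root lattice tool, host the `x`-term** (stub S6 `sqrtLatticeToolX` of the line
`fibre-toolkit-lp-wall-map`): for positive `cᵢ`, boxes with positive parameters,
`T ≥ cᵢ · ∏ⱼ (2·)^{j+1}`, `τ(m) ≤ Dτ` for `1 ≤ m ≤ T`, a set `H` of host coordinates and a coordinate
`i ≥ 1`,
`B_d ≤ #subBox_H X · #subBox_{i} Y · #subBox_{i} Z · Dτ^{d+(i+2)} · (2 + 112 YᵢZᵢ / (c₁ offVal_H X))`.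
Proof: fibre over the frozen coordinates; on a non-empty fibre the equation is
`A·m + B·y^{i+1} = C·z^{i+1}` with pairwise coprime terms, `A = c₁ offVal_H ≥ c₁ offVal_H X`,
`A ≤ T`; the pairs `(yᵢ, zᵢ)` number at most `#μ_{i+1}(ZMod A) · (2 + 112 YᵢZᵢ/A)`
(`card_pairs_rootClass_le`) with `#μ_{i+1}(ZMod A) ≤ Dτ^{i+2}` (`natCard_rootsOfUnity_le_pow`), and
over each pair the host tuples number at most `Dτ^d` (`AbcShapes.card_subBox_filter_dvd_le`, the
value `m = W_H(x)` being determined). [folklore] -/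
theorem sqrtLatticeToolX : ∀ {d : ℕ} {c₁ c₂ c₃ : ℕ}, 0 < c₁ → 0 < c₂ → 0 < c₃ → ∀ (X Y Z : Fin d → ℕ), (∀ j, 0 < X j) → (∀ j, 0 < Y j) → (∀ j, 0 < Z j) → ∀ {T Dτ : ℕ}, c₁ * Literature.NumberTheory.DiophantineGeometry.AbcShapes.shapeVal (fun j => 2 * X j) ≤ T → c₂ * Literature.NumberTheory.DiophantineGeometry.AbcShapes.shapeVal (fun j => 2 * Y j) ≤ T → c₃ * Literature.NumberTheory.DiophantineGeometry.AbcShapes.shapeVal (fun j => 2 * Z j) ≤ T → (∀ m : ℕ, m ≠ 0 → m ≤ T → m.divisors.card ≤ Dτ) → ∀ (H : Finset (Fin d)) (i : Fin d), 1 ≤ (i : ℕ) → (Literature.NumberTheory.DiophantineGeometry.AbcShapes.shapeCount c₁ c₂ c₃ X Y Z : ℝ) ≤ ((Literature.NumberTheory.DiophantineGeometry.AbcShapes.subBox H X).card * (Literature.NumberTheory.DiophantineGeometry.AbcShapes.subBox ({i} : Finset (Fin d)) Y).card * (Literature.NumberTheory.DiophantineGeometry.AbcShapes.subBox ({i} :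 Finset (Fin d)) Z).card : ℕ) * (Dτ : ℝ) ^ (d + ((i : ℕ) + 2)) * (2 + 112 * ((Y i : ℝ) * Z i) / ((c₁ * Literature.NumberTheory.DiophantineGeometry.AbcShapes.offVal H X : ℕ) : ℝ)) := by
  classical
  intro d c₁ c₂ c₃ hc₁ hc₂ hc₃ X Y Z hX hY hZ T Dτ hTX hTY hTZ hD H i hi
  set S : Finset (Fin d) := {i} with hS
  set F := shapeTriples c₁ c₂ c₃ X Y Z
  set O := subBox H X ×ˢ subBox S Y ×ˢ subBox S Z with hO
  set φ : (Fin d → ℕ) × (Fin d → ℕ) × (Fin d → ℕ) → (Fin d → ℕ) × (Fin d → ℕ) × (Fin d → ℕ) :=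
    fun t => (freezeOn H X t.1, freezeOn S Y t.2.1, freezeOn S Z t.2.2) with hφ
  have hmaps : Set.MapsTo φ (F : Set _) (O : Set _) := by
    intro t ht
    obtain ⟨hbox, -⟩ := mem_filter.mp (mem_coe.mp ht)
    simp only [mem_product] at hbox
    exact mem_coe.mpr (mem_product.mpr ⟨freezeOn_mem_subBox H hbox.1,
      mem_product.mpr ⟨freezeOn_mem_subBox S hbox.2.1, freezeOn_mem_subBox S hbox.2.2⟩⟩)
  -- general facts on the frozen values and cofactors
  have honS : ∀ u : Fin d → ℕ, onVal S u = u i ^ ((i : ℕ) + 1) := fun u => by simp [hS, onVal]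
  have hoffle : ∀ (S' : Finset (Fin d)) {W r : Fin d → ℕ}, (∀ j, 0 < r j) → (∀ j, r j ≤ 2 * W j) →
      offVal S' r ≤ shapeVal (fun j => 2 * W j) := by
    intro S' W r hr hle
    calc offVal S' r ≤ offVal S' r * onVal S' r :=
          Nat.le_mul_of_pos_right _ (prod_pos fun j _ => pow_pos (hr j) _)
      _ = shapeVal r := (shapeVal_eq_offVal_mul_onVal S' r).symm
      _ ≤ shapeVal (fun j => 2 * W j) := shapeVal_mono hle
  have hoffmono : ∀ (S' : Finset (Fin d)) {u v : Fin d → ℕ}, (∀ j, u j ≤ v j) →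
      offVal S' u ≤ offVal S' v := fun S' _ _ h =>
    prod_le_prod (fun _ _ => Nat.zero_le _) fun j _ => Nat.pow_le_pow_left (h j) _
  have hval : ∀ {w : Fin d → ℕ}, w ∈ dyadicBox X →
      onVal H w ≠ 0 ∧ (onVal H w).divisors.card ≤ Dτ := by
    intro w hw
    have hwpos : ∀ j, 0 < w j := fun j => lt_of_lt_of_le (hX j) ((mem_dyadicBox.mp hw) j).1
    have h0 : 0 < onVal H w := prod_pos fun j _ => pow_pos (hwpos j) _
    have hle : onVal H w ≤ T :=
      calc onVal H w ≤ offVal H w * onVal H w :=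
            Nat.le_mul_of_pos_left _ (prod_pos fun j _ => pow_pos (hwpos j) _)
        _ = shapeVal w := (shapeVal_eq_offVal_mul_onVal H w).symm
        _ ≤ shapeVal (fun j => 2 * X j) := shapeVal_mono fun j => ((mem_dyadicBox.mp hw) j).2.le
        _ ≤ c₁ * shapeVal (fun j => 2 * X j) := Nat.le_mul_of_pos_left _ hc₁
        _ ≤ T := hTX
    exact ⟨h0.ne', hD _ h0.ne' hle⟩
  have hfac : ∀ {v : ℕ}, v ≠ 0 → v.divisors.card ≤ Dτ →
      ((subBox Hᶜ X).filter (fun s => onVal H s = v)).card ≤ Dτ ^ d := by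
    intro v hv0 hvD
    refine (card_subBox_filter_dvd_le Hᶜ X hv0 _ fun s _ hs j hj => ?_).trans
      (Nat.pow_le_pow_left hvD d)
    rw [← hs]; exact dvd_onVal H s (by rwa [mem_compl, not_not] at hj)
  have key : ∀ (W u u' : Fin d → ℕ), freezeOn S W u = freezeOn S W u' → u i = u' i → u = u' := by
    intro W u u' hf hui
    funext j
    by_cases hj : j = i
    · rw [hj]; exact hui
    · have hjS : j ∉ S := by simp [hS, hj]
      have := congrFun hf j
      simpa [freezeOn, hjS] using this
  have hdvd : ∀ M u : ℕ, u ∣ M * u ^ ((i : ℕ) + 1) := fun M u =>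
    Dvd.dvd.mul_left (dvd_pow_self u (Nat.succ_ne_zero _)) M
  set Bnd : ℝ := (Dτ : ℝ) ^ (d + ((i : ℕ) + 2)) *
    (2 + 112 * ((Y i : ℝ) * Z i) / ((c₁ * offVal H X : ℕ) : ℝ)) with hBnd
  have hBnd0 : 0 ≤ Bnd := by positivity
  /- the bound on one fibre -/
  have hfib : ∀ o ∈ O, ((F.filter (fun t => φ t = o)).card : ℝ) ≤ Bnd := by
    rintro ⟨ox, oy, oz⟩ ho
    set Fo := F.filter (fun t => φ t = (ox, oy, oz))
    simp only [hO, mem_product] at ho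
    obtain ⟨hox, -, -⟩ := ho
    have hbx := mem_dyadicBox.mp (subBox_subset hX hox)
    have hoxpos : ∀ j, 0 < ox j := fun j => lt_of_lt_of_le (hX j) (hbx j).1
    -- the coefficients of the fibre equation `A·m + B·y^{i+1} = C·z^{i+1}`
    set A : ℕ := c₁ * offVal H ox with hA
    set B : ℕ := c₂ * offVal S oy with hB
    set C : ℕ := c₃ * offVal S oz with hC
    have hApos : 0 < A := Nat.mul_pos hc₁ (prod_pos fun j _ => pow_pos (hoxpos j) _)
    have hAT : A ≤ T := (Nat.mul_le_mul_left c₁ (hoffle H hoxpos fun j => (hbx j).2.le)).trans hTX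
    have hA₀ : c₁ * offVal H X ≤ A := Nat.mul_le_mul_left c₁ (hoffmono H fun j => (hbx j).1)
    -- what membership in the fibre means
    have hmem : ∀ t ∈ Fo, (t.1 ∈ dyadicBox X ∧ t.2.1 ∈ dyadicBox Y ∧ t.2.2 ∈ dyadicBox Z) ∧
        (freezeOn H X t.1 = ox ∧ freezeOn S Y t.2.1 = oy ∧ freezeOn S Z t.2.2 = oz) ∧
        A * onVal H t.1 + B * t.2.1 i ^ ((i : ℕ) + 1) = C * t.2.2 i ^ ((i : ℕ) + 1) ∧
        Nat.Coprime (A * onVal H t.1) (B * t.2.1 i ^ ((i : ℕ) + 1)) ∧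
        Nat.Coprime (A * onVal H t.1) (C * t.2.2 i ^ ((i : ℕ) + 1)) ∧
        Nat.Coprime (B * t.2.1 i ^ ((i : ℕ) + 1)) (C * t.2.2 i ^ ((i : ℕ) + 1)) := by
      intro t ht
      obtain ⟨htF, hφt⟩ := mem_filter.mp ht
      have hcop := coprime_terms_of_mem htF
      obtain ⟨hbox, heq, -⟩ := mem_filter.mp htF
      simp only [hφ, Prod.mk.injEq] at hφt
      obtain ⟨h1, h2, h3⟩ := hφt
      have e1 : c₁ * shapeVal t.1 = A * onVal H t.1 := by
        rw [shapeVal_eq_offVal_mul_onVal H t.1, ← offVal_freezeOn H X t.1, h1, hA, mul_assoc]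
      have e2 : c₂ * shapeVal t.2.1 = B * t.2.1 i ^ ((i : ℕ) + 1) := by
        rw [shapeVal_eq_offVal_mul_onVal S t.2.1, ← offVal_freezeOn S Y t.2.1, h2, honS, hB,
          mul_assoc]
      have e3 : c₃ * shapeVal t.2.2 = C * t.2.2 i ^ ((i : ℕ) + 1) := by
        rw [shapeVal_eq_offVal_mul_onVal S t.2.2, ← offVal_freezeOn S Z t.2.2, h3, honS, hC,
          mul_assoc]
      rw [e1, e2, e3] at heq
      rw [e1, e2] at hcop
      refine ⟨by simpa only [mem_product] using hbox, ⟨h1, h2, h3⟩, heq, hcop, ?_, ?_⟩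
      · rw [← heq]; exact Nat.coprime_self_add_right.mpr hcop
      · rw [← heq]; exact Nat.coprime_add_self_right.mpr hcop.symm
    rcases Fo.eq_empty_or_nonempty with he | ⟨t₀, ht₀⟩
    · rw [he, card_empty, Nat.cast_zero]; exact hBnd0
    obtain ⟨-, -, -, -, h13₀, -⟩ := hmem t₀ ht₀
    have hCA : C.Coprime A :=
      (h13₀.symm.coprime_dvd_left (dvd_mul_right C _)).coprime_dvd_right (dvd_mul_right A _)
    -- project the fibre to the pairs `(yᵢ, zᵢ)`
    set π : (Fin d → ℕ) × (Fin d → ℕ) × (Fin d → ℕ) → ℕ × ℕ := fun t => (t.2.1 i, t.2.2 i) with hπ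
    -- (a) over each pair the fibre has at most `Dτ^d` points
    have hFoP : Fo.card ≤ Dτ ^ d * (Fo.image π).card := by
      refine card_le_mul_card_image Fo (Dτ ^ d) fun w hw => ?_
      obtain ⟨t₁, ht₁, rfl⟩ := mem_image.mp hw
      obtain ⟨⟨hbx₁, -, -⟩, -, heq₁, -⟩ := hmem t₁ ht₁
      obtain ⟨hv0, hvD⟩ := hval hbx₁
      refine le_trans ?_ (hfac hv0 hvD)
      refine card_le_card_of_injOn (fun t => freezeOn Hᶜ X t.1) (fun t ht => ?_)
        (fun t ht t' ht' h => ?_)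
      · obtain ⟨htF, hπt⟩ := mem_filter.mp (mem_coe.mp ht)
        obtain ⟨⟨hbx', -, -⟩, -, heq, -⟩ := hmem t htF
        simp only [hπ, Prod.mk.injEq] at hπt
        have hv : onVal H t.1 = onVal H t₁.1 := by
          refine Nat.eq_of_mul_eq_mul_left hApos (Nat.add_right_cancel (heq.trans ?_))
          rw [hπt.1, hπt.2]; exact heq₁.symm
        refine mem_coe.mpr (mem_filter.mpr ⟨freezeOn_mem_subBox Hᶜ hbx', ?_⟩)
        rw [onVal_freezeOn_compl, hv]
      · obtain ⟨htF, hπt⟩ := mem_filter.mp (mem_coe.mp ht)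
        obtain ⟨ht'F, hπt'⟩ := mem_filter.mp (mem_coe.mp ht')
        obtain ⟨-, ⟨f1, f2, f3⟩, -, -⟩ := hmem t htF
        obtain ⟨-, ⟨f1', f2', f3'⟩, -, -⟩ := hmem t' ht'F
        have hyz := hπt.trans hπt'.symm
        simp only [hπ, Prod.mk.injEq] at hyz
        dsimp only at h
        refine Prod.ext ?_ (Prod.ext ?_ ?_)
        · rw [← mergeOn_freezeOn H X t.1, ← mergeOn_freezeOn H X t'.1, f1, f1', h]
        · exact key Y _ _ (f2.trans f2'.symm) hyz.1
        · exact key Z _ _ (f3.trans f3'.symm) hyz.2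
    -- (b) the pairs: root classes times primitive lattice points
    have hPle : ((Fo.image π).card : ℝ) ≤ Nat.card {ρ : ZMod A // ρ ^ ((i : ℕ) + 1) = 1} *
        (2 + 28 * ((2 * Y i : ℕ) : ℝ) * ((2 * Z i : ℕ) : ℝ) / A) := by
      refine card_pairs_rootClass_le hApos hCA B ((i : ℕ) + 1) (2 * Y i) (2 * Z i) (Fo.image π)
        fun w hw => ?_
      obtain ⟨t, ht, rfl⟩ := mem_image.mp hw
      obtain ⟨⟨-, hby', hbz'⟩, -, heq, h12, h13, h23⟩ := hmem t ht
      simp only [hπ]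
      refine ⟨⟨((mem_dyadicBox.mp hby') i).2.le, ((mem_dyadicBox.mp hbz') i).2.le⟩, ?_, ?_, ?_, ?_⟩
      · exact (h23.coprime_dvd_left (hdvd B _)).coprime_dvd_right (hdvd C _)
      · exact (h12.symm.coprime_dvd_left (hdvd B _)).coprime_dvd_right (dvd_mul_right A _)
      · exact (h13.symm.coprime_dvd_left (hdvd C _)).coprime_dvd_right (dvd_mul_right A _)
      · have h := congrArg (Nat.cast : ℕ → ZMod A) heq
        push_cast at h
        rwa [ZMod.natCast_self, zero_mul, zero_add] at h
    have hroots : Nat.card {ρ : ZMod A // ρ ^ ((i : ℕ) + 1) = 1} ≤ Dτ ^ ((i : ℕ) + 2) :=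
      natCard_rootsOfUnity_le_pow hApos.ne' (hD A hApos.ne' hAT)
    -- (c) assemble
    have h0 : (0 : ℝ) < ((c₁ * offVal H X : ℕ) : ℝ) := by
      exact_mod_cast Nat.mul_pos hc₁ (prod_pos fun j _ => pow_pos (hX j) _)
    have h1 : ((c₁ * offVal H X : ℕ) : ℝ) ≤ (A : ℝ) := by exact_mod_cast hA₀
    have h2 : 112 * ((Y i : ℝ) * Z i) / A ≤ 112 * ((Y i : ℝ) * Z i) / ((c₁ * offVal H X : ℕ) : ℝ) :=
      div_le_div_of_nonneg_left (by positivity) h0 h1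
    calc (Fo.card : ℝ) ≤ ((Dτ ^ d * (Fo.image π).card : ℕ) : ℝ) := by exact_mod_cast hFoP
      _ = (Dτ : ℝ) ^ d * (Fo.image π).card := by push_cast; ring
      _ ≤ (Dτ : ℝ) ^ d * (Nat.card {ρ : ZMod A // ρ ^ ((i : ℕ) + 1) = 1} *
            (2 + 28 * ((2 * Y i : ℕ) : ℝ) * ((2 * Z i : ℕ) : ℝ) / A)) :=
          mul_le_mul_of_nonneg_left hPle (by positivity)
      _ ≤ (Dτ : ℝ) ^ d * (((Dτ ^ ((i : ℕ) + 2) : ℕ) : ℝ) *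
            (2 + 28 * ((2 * Y i : ℕ) : ℝ) * ((2 * Z i : ℕ) : ℝ) / A)) :=
          mul_le_mul_of_nonneg_left (mul_le_mul_of_nonneg_right (by exact_mod_cast hroots)
            (by positivity)) (by positivity)
      _ = (Dτ : ℝ) ^ (d + ((i : ℕ) + 2)) * (2 + 112 * ((Y i : ℝ) * Z i) / A) := by
          push_cast; ring
      _ ≤ Bnd := by
          rw [hBnd]
          exact mul_le_mul_of_nonneg_left (by linarith) (by positivity)
  /- summing over the fibres -/
  calc (shapeCount c₁ c₂ c₃ X Y Z : ℝ) = (F.card : ℝ) := rfl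
    _ = ∑ o ∈ O, ((F.filter (fun t => φ t = o)).card : ℝ) := by
        rw [card_eq_sum_card_fiberwise hmaps]; push_cast; rfl
    _ ≤ ∑ o ∈ O, Bnd := sum_le_sum hfib
    _ = O.card * Bnd := by rw [sum_const, nsmul_eq_mul]
    _ = _ := by rw [hO, card_product, card_product, hBnd]; push_cast; ring

end Summit.ABC.ABC.Theorems.MazurKaneLaw
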